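import Mathlib
import Summits.MatrixMultiplication.Statement
import Summits.MatrixMultiplication.MatrixMultiplication.Theorems.GraphEquationsPureFormsNec
import Summits.MatrixMultiplication.MatrixMultiplication.Theorems.GraphEquationsCoeffIdentity
import Summits.MatrixMultiplication.MatrixMultiplication.Theorems.GraphEquationsLowestFormReadOut

/-!
# Quadric tests are reduced: the finite range `deg ≤ 2` of `H_mult` (`GraphEquations`, M33)

Decomp-mm node «GraphEquations» (lens 5 «finite range + asymptotic regime + bridge», g37); attacked
leaf `MultiplicityReduction` (stmt-MatrixMultiplication-27806).  Target of the node, VERBATIM: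
`_root_.MatrixMultiplication`.  Route-neutral (`closes` unchanged); imports no `Theses/` file.

THE FINITE RANGE OF THE LENS, INDEXED BY DEGREE.  `H_mult` asks to replace a cheap correct system
for `W_n = {C = AB}` by a cheap GENERICALLY REDUCED one.  This file proves that for systems whose
tests have total degree `≤ 2` there is nothing to do, uniformly in `n` and with NO exponent loss:

* `eval_cPoint_of_vanishing_of_totalDegree_le_two` — a polynomial `t` of degree `≤ 2` vanishing on
  `W_n` satisfies `t(0, 0, V) = Σ_q coeff_{c_q}(t) · V_q` for every `V` (its weight-`0,1,3`
  components vanish at `(0,0,V)`, its weight-`2` component is `Σ_q coeff_{c_q}(t) f_q` (M11), and its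
  weight-`4` component is a pure `C`-quadric vanishing on `W_n`, hence at `(V, 𝟙, V) ∈ W_n`).
* `EqSystem.reducedAt_zero_of_isQuadratic` — **a correct system with tests of degree `≤ 2` is
  REDUCED AT THE ORIGIN**: if `J_C(0) V = 0` then `(0,0,V)` passes every test, so `V = 0·0 = 0`.
* `tensorRank_le_of_isQuadratic : R(⟨n,n,n⟩) ≤ 2 · cost E` (with M7 `reducedSystemsCostRankZero_holds`)
  — EXACT rank, multiplier `1`; and `eqAdmissibleRed_of_eqAdmissibleQuad : EqAdmissibleQuad β →
  EqAdmissibleRed β` (`H_mult` on the quadratic range with `β' = β`).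

Degree ladder of record (NODE g37): `deg ≤ 2` PROVED here; `deg ≤ 3` = Conjecture C3 (cubic correct
systems are generically reduced; structure theorem in the node memo, UNDECIDED with test); `deg ≤ 4`
strong form REFUTED by M31's masked family `(f₀₀, f₀₁, f₁₀, f₁₁² − a₀₀f₀₀)` (nowhere lowest-form
nondegenerate) but unmaskable with one product (M32).  No `sorry`.
Sources: [BurgisserClausenShokrollahi1997, (14.8), Problem 16.3], [Strassen1973] (Vermeidung).
-/

set_option linter.dupNamespace false

noncomputable section

open scoped BigOperators

namespace Summit.MatrixMultiplication.MatrixMultiplication.Theorems.GraphEquations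

open MvPolynomial
open Literature.Computability.AlgebraicComplexity
open Literature.Computability.AlgebraicComplexity.ArithCircuit

variable {n : ℕ}

/-! ## Weight versus degree of an exponent -/

/-- `weight μ ≤ 2 · |μ|` (the weights are `1, 1, 2`). -/
theorem weight_le_two_mul_degree (μ : GraphVars n →₀ ℕ) :
    Finsupp.weight (gw n) μ ≤ 2 * μ.sum (fun _ e => e) := by
  rw [Finsupp.weight_apply, Finsupp.sum, Finsupp.sum, Finset.mul_sum]
  refine Finset.sum_le_sum fun v _ => ?_
  rcases v with v | v <;> simp [gw, smul_eq_mul] <;> omega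

/-- Equality `weight μ = 2 · |μ|` forces `μ` to be a pure `C`-exponent. -/
theorem inl_eq_zero_of_weight_eq (μ : GraphVars n →₀ ℕ)
    (h : Finsupp.weight (gw n) μ = 2 * μ.sum (fun _ e => e)) (w : MatMulVars n) :
    μ (Sum.inl w) = 0 := by
  classical
  rw [Finsupp.weight_apply, Finsupp.sum, Finsupp.sum, Finset.mul_sum] at h
  have hle : ∀ v ∈ μ.support, μ v • gw n v ≤ 2 * μ v := fun v _ => by
    rcases v with v | v <;> simp [gw, smul_eq_mul] <;> omega
  have heq := (Finset.sum_eq_sum_iff_of_le hle).1 h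
  by_contra hw
  have hmem : (Sum.inl w : GraphVars n) ∈ μ.support := Finsupp.mem_support_iff.2 hw
  have := heq _ hmem
  simp [gw, smul_eq_mul] at this
  omega

/-- A pure `C`-exponent has weight `2 · |μ|` (even). -/
theorem weight_eq_of_inl_eq_zero (μ : GraphVars n →₀ ℕ) (h : ∀ w : MatMulVars n, μ (Sum.inl w) = 0) :
    Finsupp.weight (gw n) μ = 2 * μ.sum (fun _ e => e) := by
  classical
  rw [Finsupp.weight_apply, Finsupp.sum, Finsupp.sum, Finset.mul_sum]
  refine Finset.sum_congr rfl fun v hv => ?_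
  rcases v with w | q
  · exact absurd (h w) (Finsupp.mem_support_iff.1 hv)
  · simp [gw, smul_eq_mul, mul_comm]

/-- An exponent of ODD weight involves an `A`- or `B`-variable. -/
theorem exists_inl_ne_zero_of_odd_weight (μ : GraphVars n →₀ ℕ) (h : Odd (Finsupp.weight (gw n) μ)) :
    ∃ w : MatMulVars n, μ (Sum.inl w) ≠ 0 := by
  by_contra hno
  push Not at hno
  rw [weight_eq_of_inl_eq_zero μ hno] at h
  exact (Nat.not_odd_iff_even.2 (even_two_mul _)) h

/-! ## The points `(0, 0, V)` -/

/-- The point `(A, B, C) = (0, 0, V)`. -/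
def cPoint (v : Fin n × Fin n → ℂ) : GraphVars n → ℂ := fun w => Sum.elim (fun _ => 0) v w

/-- `(0,0,V)` has zero `A`, `B`. -/
@[simp] theorem cPoint_inl (v : Fin n × Fin n → ℂ) (w : MatMulVars n) : cPoint v (Sum.inl w) = 0 := rfl

/-- `(0,0,V)` has `C = V`. -/
@[simp] theorem cPoint_inr (v : Fin n × Fin n → ℂ) (q : Fin n × Fin n) : cPoint v (Sum.inr q) = v q :=
  rfl

/-- `(0, 0, V) ∈ W_n ↔ V = 0`. -/
theorem cPoint_mem_mmGraph_iff (v : Fin n × Fin n → ℂ) : cPoint v ∈ mmGraph n ↔ v = 0 := by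
  constructor
  · intro h
    funext q
    simpa using h q.1 q.2
  · rintro rfl
    intro i l
    simp

/-- A monomial involving an `A`- or `B`-variable vanishes at `(0, 0, V)`. -/
theorem eval_cPoint_monomial_eq_zero (v : Fin n × Fin n → ℂ) {μ : GraphVars n →₀ ℕ}
    {w : MatMulVars n} (hw : μ (Sum.inl w) ≠ 0) (a : ℂ) : eval (cPoint v) (monomial μ a) = 0 := by
  classical
  rw [eval_monomial, Finsupp.prod,
    Finset.prod_eq_zero (i := Sum.inl w) (Finsupp.mem_support_iff.2 hw) (by simp [zero_pow hw]),
    mul_zero]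

/-- A polynomial all of whose monomials involve an `A`- or `B`-variable vanishes at `(0, 0, V)`. -/
theorem eval_cPoint_eq_zero_of_support (v : Fin n × Fin n → ℂ) {p : MvPolynomial (GraphVars n) ℂ}
    (hp : ∀ μ ∈ p.support, ∃ w : MatMulVars n, μ (Sum.inl w) ≠ 0) : eval (cPoint v) p = 0 := by
  rw [p.as_sum, map_sum]
  refine Finset.sum_eq_zero fun μ hμ => ?_
  obtain ⟨w, hw⟩ := hp μ hμ
  exact eval_cPoint_monomial_eq_zero v hw _

/-- A pure `C`-polynomial depends only on the `C`-coordinates. -/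
theorem eval_eq_eval_of_inl_free {p : MvPolynomial (GraphVars n) ℂ}
    (hp : ∀ μ ∈ p.support, ∀ w : MatMulVars n, μ (Sum.inl w) = 0) {x x' : GraphVars n → ℂ}
    (h : ∀ q, x (Sum.inr q) = x' (Sum.inr q)) : eval x p = eval x' p := by
  classical
  rw [p.as_sum, map_sum, map_sum]
  refine Finset.sum_congr rfl fun μ hμ => ?_
  rw [eval_monomial, eval_monomial, Finsupp.prod, Finsupp.prod]
  congr 1
  refine Finset.prod_congr rfl fun w hw => ?_
  rcases w with w | q
  · exact absurd (hp μ hμ w) (Finsupp.mem_support_iff.1 hw)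
  · rw [h q]

/-- Components of ODD weight vanish at `(0, 0, V)` (any polynomial). -/
theorem eval_cPoint_weightedHomogeneousComponent_odd (v : Fin n × Fin n → ℂ)
    (p : MvPolynomial (GraphVars n) ℂ) {d : ℕ} (hd : Odd d) :
    eval (cPoint v) (weightedHomogeneousComponent (gw n) d p) = 0 := by
  refine eval_cPoint_eq_zero_of_support v fun μ hμ => exists_inl_ne_zero_of_odd_weight μ ?_
  rwa [weightedHomogeneousComponent_isWeightedHomogeneous (w := gw n) (n := d) (φ := p)
    (mem_support_iff.1 hμ)]

/-! ## Weighted components of vanishing polynomials vanish on the graph -/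

/-- Every weighted component of `g · f_q` vanishes on `W_n` (only `(f_q)_{(2)} = f_q` is nonzero). -/
theorem eval_weightedHomogeneousComponent_mul_generator (g : MvPolynomial (GraphVars n) ℂ)
    (q : Fin n × Fin n) (d : ℕ) {y : GraphVars n → ℂ} (hy : y ∈ mmGraph n) :
    eval y (weightedHomogeneousComponent (gw n) d (g * generator n q)) = 0 := by
  classical
  rw [weightedHomogeneousComponent_mul, map_sum]
  refine Finset.sum_eq_zero fun ij _ => ?_
  rw [map_mul, weightedHomogeneousComponent_generator]
  split_ifs
  · rw [eval_generator_of_mem hy, mul_zero]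
  · rw [map_zero, mul_zero]

/-- **The weighted components of a polynomial vanishing on `W_n` vanish on `W_n`** (the ideal
`(f_q)_q` is weighted-homogeneous). -/
theorem eval_weightedHomogeneousComponent_eq_zero_of_vanishing {t : MvPolynomial (GraphVars n) ℂ}
    (ht : ∀ y ∈ mmGraph n, eval y t = 0) (d : ℕ) {y : GraphVars n → ℂ} (hy : y ∈ mmGraph n) :
    eval y (weightedHomogeneousComponent (gw n) d t) = 0 := by
  classical
  obtain ⟨g, hg⟩ := Ideal.mem_span_range_iff_exists_fun.mp (mem_span_generator_of_vanishing ht)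
  rw [← hg, map_sum, map_sum]
  exact Finset.sum_eq_zero fun q _ => eval_weightedHomogeneousComponent_mul_generator _ _ _ hy

/-! ## Quadrics vanishing on the graph, evaluated at `(0, 0, V)` -/

/-- The graph point `(V, 𝟙, V)`. -/
def diagGraphPoint (v : Fin n × Fin n → ℂ) : GraphVars n → ℂ :=
  graphPoint fun w => Sum.elim v (fun kl : Fin n × Fin n => if kl.1 = kl.2 then 1 else 0) w

/-- `(V, 𝟙, V) ∈ W_n`. -/
theorem diagGraphPoint_mem (v : Fin n × Fin n → ℂ) : diagGraphPoint v ∈ mmGraph n :=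
  graphPoint_mem_mmGraph _

/-- `(V, 𝟙, V)` has `C = V`. -/
theorem diagGraphPoint_inr (v : Fin n × Fin n → ℂ) (q : Fin n × Fin n) :
    diagGraphPoint v (Sum.inr q) = v q := by
  obtain ⟨i, l⟩ := q
  simp [diagGraphPoint, graphPoint, Finset.sum_ite_eq']

/-- **A quadric vanishing on `W_n`, at `(0,0,V)`, equals its linear `C`-part at `V`**:
`t(0, 0, V) = Σ_q coeff_{c_q}(t) · V_q` whenever `deg t ≤ 2` and `t|_{W_n} = 0`. -/
theorem eval_cPoint_of_vanishing_of_totalDegree_le_two {t : MvPolynomial (GraphVars n) ℂ}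
    (ht : ∀ y ∈ mmGraph n, eval y t = 0) (hdeg : t.totalDegree ≤ 2) (v : Fin n × Fin n → ℂ) :
    eval (cPoint v) t = ∑ q : Fin n × Fin n, coeff (Finsupp.single (Sum.inr q) 1) t * v q := by
  classical
  -- weights of the support are `≤ 4`
  have hdegμ : ∀ μ ∈ t.support, μ.sum (fun _ e => e) ≤ 2 := fun μ hμ =>
    (le_totalDegree hμ).trans hdeg
  have hS : ∀ μ ∈ t.support, Finsupp.weight (gw n) μ ∈ Finset.range 5 := fun μ hμ =>
    Finset.mem_range.2 (by have := weight_le_two_mul_degree μ; have := hdegμ μ hμ; omega)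
  -- component by component
  have e0 : eval (cPoint v) (weightedHomogeneousComponent (gw n) 0 t) = 0 := by
    have h0 : coeff 0 t = 0 := by
      have := ht 0 (zero_mem_mmGraph n)
      simpa [constantCoeff_eq] using this
    rw [weightedHomogeneousComponent_zero _ gw_ne_zero, h0, map_zero, map_zero]
  have e1 := eval_cPoint_weightedHomogeneousComponent_odd v t (d := 1) (by decide)
  have e3 := eval_cPoint_weightedHomogeneousComponent_odd v t (d := 3) (by decide)
  have e2 : eval (cPoint v) (weightedHomogeneousComponent (gw n) 2 t) =
      ∑ q : Fin n × Fin n, coeff (Finsupp.single (Sum.inr q) 1) t * v q := by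
    rw [weightedHomogeneousComponent_two_of_vanishing ht, map_sum]
    refine Finset.sum_congr rfl fun q _ => ?_
    rw [smul_eval]
    congr 1
    obtain ⟨i, l⟩ := q
    simp [generator]
  have e4 : eval (cPoint v) (weightedHomogeneousComponent (gw n) 4 t) = 0 := by
    -- the weight-4 component is a pure `C`-quadric …
    have hfree : ∀ μ ∈ (weightedHomogeneousComponent (gw n) 4 t).support, ∀ w : MatMulVars n,
        μ (Sum.inl w) = 0 := by
      intro μ hμ
      have hc := mem_support_iff.1 hμ
      rw [coeff_weightedHomogeneousComponent] at hc
      split_ifs at hc with hw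
      · refine inl_eq_zero_of_weight_eq μ (le_antisymm (weight_le_two_mul_degree μ) ?_)
        have := hdegμ μ (mem_support_iff.2 hc)
        omega
      · exact absurd rfl hc
    -- … so its value at `(0,0,V)` is its value at the graph point `(V, 𝟙, V)`
    rw [eval_eq_eval_of_inl_free hfree (x' := diagGraphPoint v) fun q => by
      rw [cPoint_inr, diagGraphPoint_inr]]
    exact eval_weightedHomogeneousComponent_eq_zero_of_vanishing ht 4 (diagGraphPoint_mem v)
  conv_lhs => rw [eq_sum_weightedHomogeneousComponent t hS, map_sum]
  simp only [Finset.sum_range_succ, Finset.sum_range_zero, zero_add, e0, e1, e2, e3, e4, add_zero]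

/-! ## Quadratic systems are reduced at the origin -/

namespace EqSystem

/-- QUADRATIC system: every test has total degree `≤ 2`. -/
def IsQuadratic (E : EqSystem n) : Prop :=
  ∀ o : Fin E.tests.length, (E.testPoly (E.tests.get o)).totalDegree ≤ 2

/-- **FR(2): a correct quadratic system is REDUCED AT THE ORIGIN** (`rank J_C(0) = n²`): a kernel
vector `V` of `J_C(0)` makes `(0, 0, V)` pass every test, and `(0, 0, V) ∈ W_n` forces `V = 0`. -/
theorem reducedAt_zero_of_isQuadratic {E : EqSystem n} (hE : E.Correct) (h2 : E.IsQuadratic) :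
    E.ReducedAt 0 := by
  classical
  have hker : ∀ v : Fin n × Fin n → ℂ, (E.jacobianC 0).mulVec v = 0 → v = 0 := by
    intro v hv
    have hz : cPoint v ∈ E.zeroSet := by
      intro j hj
      obtain ⟨o, ho⟩ := List.mem_iff_get.1 hj
      rw [← ho, eval_cPoint_of_vanishing_of_totalDegree_le_two
        (fun y hy => hE.eval_testPoly_eq_zero hy (List.get_mem _ _)) (h2 o) v]
      have h := congr_fun hv o
      simp only [Matrix.mulVec, dotProduct, Pi.zero_apply, jacobianC_zero_apply] at h
      exact h
    rw [hE.2, cPoint_mem_mmGraph_iff] at hz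
    exact hz
  have hbot : LinearMap.ker (E.jacobianC 0).mulVecLin = ⊥ :=
    Matrix.ker_mulVecLin_eq_bot_iff.mpr hker
  have h1 := LinearMap.finrank_range_add_finrank_ker (E.jacobianC 0).mulVecLin
  rw [hbot, finrank_bot, add_zero] at h1
  show Module.finrank ℂ (LinearMap.range (E.jacobianC 0).mulVecLin) = n * n
  rw [h1]
  simp

/-- Hence generically reduced. -/
theorem genericallyReduced_of_isQuadratic {E : EqSystem n} (hE : E.Correct) (h2 : E.IsQuadratic) :
    E.GenericallyReduced :=
  genericallyReduced_of_reducedAt_zero (reducedAt_zero_of_isQuadratic hE h2)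

end EqSystem

/-- **`R(⟨n,n,n⟩) ≤ 2 · cost` for every correct QUADRATIC system** — exact rank, multiplier `1`,
uniform in `n` (FR(2) + M7 `reducedSystemsCostRankZero_holds`). -/
theorem tensorRank_le_of_isQuadratic {E : EqSystem n} (hE : E.Correct) (h2 : E.IsQuadratic) :
    tensorRank (matMulTensor ℂ n n n) ≤ 2 * E.cost :=
  reducedSystemsCostRankZero_holds n E hE (EqSystem.reducedAt_zero_of_isQuadratic hE h2)

/-! ## The quadratic range of the dial -/

/-- `EqAdmissibleQuad β`: correct QUADRATIC systems of cost `O(n^β)` exist for all `n ≥ 1`. -/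
def EqAdmissibleQuad (β : ℝ) : Prop :=
  ∃ c : ℝ, ∀ n : ℕ, 1 ≤ n → ∃ E : EqSystem n, E.Correct ∧ E.IsQuadratic ∧
    (E.cost : ℝ) ≤ c * (n : ℝ) ^ β

/-- **`H_mult` on the quadratic range, with NO exponent loss**: `EqAdmissibleQuad β →
EqAdmissibleRed β` (the systems themselves are generically reduced). -/
theorem eqAdmissibleRed_of_eqAdmissibleQuad {β : ℝ} (h : EqAdmissibleQuad β) : EqAdmissibleRed β := by
  obtain ⟨c, hc⟩ := h
  refine ⟨c, fun n hn => ?_⟩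
  obtain ⟨E, hE, h2, hcost⟩ := hc n hn
  exact ⟨E, hE, EqSystem.genericallyReduced_of_isQuadratic hE h2, hcost⟩

/-- Quadratic admissibility implies admissibility. -/
theorem EqAdmissibleQuad.eqAdmissible {β : ℝ} (h : EqAdmissibleQuad β) : EqAdmissible β :=
  (eqAdmissibleRed_of_eqAdmissibleQuad h).eqAdmissible

end Summit.MatrixMultiplication.MatrixMultiplication.Theorems.GraphEquations
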